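import Summits.ValiantsHypothesis.ValiantsHypothesis.Theses.ImmanantSlice
import Literature.Computability.AlgebraicComplexity.ArithCircuitProofs
import Literature.Computability.AlgebraicComplexity.FermionicPencil

/-!
# Route ImmanantSlice — item `AlphaPencil` (stmt-ValiantsHypothesis-4215)

The α-pencil interpolation lemma: if for some `c` and every `n` at least `n + 1` distinct `α ∈ ℂ`
have `L(per_{α,n}) ≤ n ^ c + c`, where `per_{α,n} = ∑_σ α^{c(σ)} ∏ᵢ X_{σ i, i}` and `c(σ)` counts the
cycles of `σ` including fixed points (`Equiv.Perm.numCycles`), then the permanent family is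
p-computable.

Proof (Lagrange/Vandermonde interpolation in `α`): pick `n + 1` distinct nodes `α₀, …, αₙ` among the
cheap ones; since `c(σ) ≤ n` (`Equiv.Perm.numCycles_le_card`) and the Vandermonde matrix of the nodes
is invertible (`Matrix.det_vandermonde_ne_zero_iff`), there are weights `ℓⱼ` with
`∑ⱼ ℓⱼ αⱼ^k = 1` for all `k ≤ n`, whence `per_n = ∑ⱼ ℓⱼ • per_{αⱼ,n}` and
`L(per_n) ≤ (n + 1)(n ^ c + c + 2)` by `complexity_finset_sum_le` / `complexity_smul_le`.
-/

namespace Summit.ValiantsHypothesis.Theorems.ImmanantSliceAlphaPencil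

open MvPolynomial Literature.Computability.AlgebraicComplexity

/-- Evaluation at `1` is a linear combination of evaluations at any `m` distinct nodes, for
polynomials of degree `< m`: for an injective `v : Fin m → ℂ` there are weights `ℓ` with
`∑ⱼ ℓ j * v j ^ k = 1` for every `k < m` (the row vector `ℓ = 𝟙 V⁻¹` for the invertible
Vandermonde matrix `V` of `v`). -/
theorem exists_weights_vandermonde {m : ℕ} (v : Fin m → ℂ) (hv : Function.Injective v) :
    ∃ ℓ : Fin m → ℂ, ∀ k : Fin m, ∑ j, ℓ j * v j ^ (k : ℕ) = 1 := by
  have hdet : IsUnit (Matrix.vandermonde v) := by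
    rw [Matrix.isUnit_iff_isUnit_det, isUnit_iff_ne_zero, Matrix.det_vandermonde_ne_zero_iff]
    exact hv
  obtain ⟨ℓ, hℓ⟩ := (Matrix.vecMul_surjective_iff_isUnit.2 hdet) (fun _ => 1)
  refine ⟨ℓ, fun k => ?_⟩
  have h := congrFun hℓ k
  simpa [Matrix.vecMul, dotProduct, Matrix.vandermonde_apply] using h

/-- The interpolation identity: if `v : Fin m → ℂ` are nodes and `ℓ` weights with
`∑ⱼ ℓ j * v j ^ k = 1` for all `k < m`, and `m > n`, then
`∑ⱼ ℓ j • per_{v j, n} = per_n`, where `per_{α,n} = ∑_σ α^{c(σ)} ∏ᵢ X_{σ i, i}`. -/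
theorem sum_smul_alphaPer_eq_perPoly {n m : ℕ} (v ℓ : Fin m → ℂ)
    (hℓ : ∀ k : Fin m, ∑ j, ℓ j * v j ^ (k : ℕ) = 1) (hnm : n < m) :
    ∑ j : Fin m, ℓ j • (∑ σ : Equiv.Perm (Fin n),
        C (v j ^ σ.numCycles) * ∏ i : Fin n, X (σ i, i)) = perPoly (Fin n) ℂ := by
  have hcoef : ∀ σ : Equiv.Perm (Fin n), ∑ j : Fin m, ℓ j * v j ^ σ.numCycles = 1 := fun σ =>
    hℓ ⟨σ.numCycles, lt_of_le_of_lt (by simpa using σ.numCycles_le_card) hnm⟩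
  calc ∑ j : Fin m, ℓ j • (∑ σ : Equiv.Perm (Fin n), C (v j ^ σ.numCycles) * ∏ i : Fin n, X (σ i, i))
      = ∑ j : Fin m, ∑ σ : Equiv.Perm (Fin n),
          C (ℓ j * v j ^ σ.numCycles) * ∏ i : Fin n, X (σ i, i) := by
        refine Finset.sum_congr rfl fun j _ => ?_
        rw [Finset.smul_sum]
        refine Finset.sum_congr rfl fun σ _ => ?_
        rw [smul_eq_C_mul, ← mul_assoc, ← C_mul]
    _ = ∑ σ : Equiv.Perm (Fin n), ∑ j : Fin m,
          C (ℓ j * v j ^ σ.numCycles) * ∏ i : Fin n, X (σ i, i) := Finset.sum_comm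
    _ = ∑ σ : Equiv.Perm (Fin n), ∏ i : Fin n, (X (σ i, i) : MvPolynomial (Fin n × Fin n) ℂ) := by
        refine Finset.sum_congr rfl fun σ _ => ?_
        have h := congrArg (C : ℂ → MvPolynomial (Fin n × Fin n) ℂ) (hcoef σ)
        rw [map_sum, map_one] at h
        rw [← Finset.sum_mul, h, one_mul]
    _ = perPoly (Fin n) ℂ := perPoly_eq_sum.symm

/-- **α-pencil interpolation** (item stmt-ValiantsHypothesis-4215 of route ImmanantSlice): if for
some `c` and every `n` more than `n` distinct `α ∈ ℂ` have `L(per_{α,n}) ≤ n ^ c + c`, where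
`per_{α,n} = ∑_σ α^{c(σ)} ∏ᵢ X_{σ i, i}` with `c(σ)` the number of cycles of `σ` counted with fixed
points, then `(per_n)_n` is p-computable: `per_n` is a linear combination of `n + 1` of the cheap
`per_{α,n}` (Vandermonde interpolation in `α`, `c(σ) ≤ n`), so `L(per_n) ≤ (n + 1)(n ^ c + c + 2)`. -/
theorem alphaPencil_proof :
    Summit.ValiantsHypothesis.ValiantsHypothesis.Theses.ImmanantSlice.AlphaPencil := by
  unfold Summit.ValiantsHypothesis.ValiantsHypothesis.Theses.ImmanantSlice.AlphaPencil
  rintro ⟨c, hc⟩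
  have key : ∀ n : ℕ, complexity (perPoly (Fin n) ℂ) ≤ (n + 1) * (n ^ c + c + 2) := by
    intro n
    obtain ⟨S, hS, hα⟩ := hc n
    have hα' : ∀ α ∈ S, complexity (∑ σ : Equiv.Perm (Fin n),
        C (α ^ σ.numCycles) * ∏ i : Fin n, X (σ i, i)) ≤ n ^ c + c := hα
    obtain ⟨e⟩ : Nonempty (Fin (n + 1) ↪ S) :=
      Function.Embedding.nonempty_of_card_le (by simpa using hS)
    obtain ⟨ℓ, hℓ⟩ := exists_weights_vandermonde (fun j => (e j : ℂ))
      (Subtype.val_injective.comp e.injective)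
    rw [← sum_smul_alphaPer_eq_perPoly (fun j => (e j : ℂ)) ℓ hℓ (Nat.lt_succ_self n)]
    calc complexity (∑ j : Fin (n + 1), ℓ j • ∑ σ : Equiv.Perm (Fin n),
            C ((e j : ℂ) ^ σ.numCycles) * ∏ i : Fin n, X (σ i, i))
        ≤ ∑ j : Fin (n + 1), complexity (ℓ j • ∑ σ : Equiv.Perm (Fin n),
            C ((e j : ℂ) ^ σ.numCycles) * ∏ i : Fin n, X (σ i, i)) +
            (Finset.univ : Finset (Fin (n + 1))).card := complexity_finset_sum_le _ _
      _ ≤ ∑ _j : Fin (n + 1), (n ^ c + c + 1) + (n + 1) := by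
          gcongr with j _
          · exact (complexity_smul_le_holds _ _).trans
              (Nat.add_le_add_right (hα' _ (e j).2) 1)
          · simp
      _ = (n + 1) * (n ^ c + c + 2) := by
          simp only [Finset.sum_const, Finset.card_univ, Fintype.card_fin, smul_eq_mul]
          ring
  refine IsPBounded.mono (t := fun n => (n + 1) * (n ^ c + c + 2)) ?_ key
  exact IsPBounded.mul_holds (IsPBounded.add_holds IsPBounded.id (IsPBounded.const 1))
    (IsPBounded.add_holds ⟨c, fun n => le_rfl⟩ (IsPBounded.const 2))

end Summit.ValiantsHypothesis.Theorems.ImmanantSliceAlphaPencil
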